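import Summits.HodgeConjecture.HodgeConjecture.Theorems.Ring2AbelianAllAndreWeilFieldPencils
import Literature.AlgebraicGeometry.Deligne1982.TensorPointOfPower
import Literature.AlgebraicGeometry.Deligne1982.PolarizedHyperbolicWeilTypeCMAnchor
import Literature.AlgebraicGeometry.HodgeTheory.WeilClassesTensorPointIsogenyCone
import Literature.AlgebraicGeometry.Motives.AbelianVarietyExistence
import HarnessLib

/-!
# Ring 2 · AbelianAll — ANDRÉ AXIS, PART R-e: AN UNCONDITIONAL ANCHOR FOR EVERY CM FIELD — for every CM datum `(R, e₀)` (`E = ℚ[T]/(R(T²))` a CM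
  field of degree `2e₀`) and every `k ≥ 1`, Deligne's tensor point `(E₁^k)^{2e₀} = E₁^k ⊗ E` (`E₁` an elliptic curve) is an abelian
  `2ke₀`-fold of Weil type relative to `E`, with ALGEBRAIC `E`-Weil classes, satisfying the HODGE CONJECTURE, polarized SPLIT; and on EVERY compact
  pencil of abelian `2ke₀`-folds with `B⋆` of its one total space, a global `E`-action and a chart `E`-isogenous to this anchor, the `E`-Weil
  classes of EVERY member are algebraic (∃ anchor ∀ pencils; fact-free — the CM-field form of part Q-d)

HONEST FRAMING (page 1, verbatim): **research route, not a corollary; conditional on HC_CM plus one named minimal statement.** Cell line: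
research route conditional on HC_CM; not a corollary; Q11.4-sentence-2 already refuted in dim ≥ 3. Nothing in this file proves a case of the
Hodge conjecture (beyond the tree's powers of an elliptic curve and Deligne's tensor points) or of `B(X)` for a named `X`: the pencil rows are
IMPLICATIONS with displayed hypotheses. `HC_CM`, `HC_AV` and the global nodes do NOT occur. Item `Theses.RankFourFaces.CMToAbelian` (stmt-16267)
stays OPEN; N104 untouched; no node is born (0 `def`, 0 `sorry`, no named fact). Seat `pub-hodge-ring2-ab-andre-2`, gen 48 (part R: the André
axis for CM fields). Inputs: part R-b §1 (`…_of_lefschetzB_of_weilClassesField_le_chart`), the tree's UNCONDITIONAL tensor point on a power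
(`Deligne1982.exists_tensorPoint_powSucc`: companion endomorphism of `R(T²)` on `T^{2e₀}`, Weil type, `W_E ⊗ ℂ` algebraic, a rational algebraic
Kähler Rosati-compatible SPLIT polarization class), `E`-isogeny transport of the algebraicity of `W_E` from a companion product cone
(`weilClassesField_le_algebraicClasses_of_isogenyPair_companion`), HC for powers of powers of ANY elliptic curve (`hodgeConjectureFor_powSucc_powSucc`),
and the existence of an elliptic curve over `ℂ` (`exists_abelianVariety_dim_eq_one`).

## Content (theorems only; standard axioms)

* **`exists_weilFieldAnchor`** — HYPOTHESIS-FREE EXISTENCE (AV level): for every CM datum `(R, e₀)` and `k ≥ 1` there are an abelian variety `A₀`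
  with `φ₀ : A₀ ⟶ A₀`, an abelian `k`-fold `T` and a product-cone presentation `q : Fin 2e₀ → (A₀ ⟶ T)` in which `φ₀` is the companion endomorphism
  of `R(T²)`, such that: `IsWeilTypeCM A₀ φ₀ R e₀ k`; `weilClassesField A₀ φ₀ (R(T²)) (2k) ⊆ Nᵏ(A₀)`; `HodgeConjectureFor A₀.dim A₀.X`; `A₀` carries a
  rational algebraic Rosati-compatible SPLIT polarization class a real multiple of which is Kähler; and EVERY `(Y, ψ)` `E`-isogenous to `(A₀, φ₀)`
  (`u : Y ⟶ A₀`, `v : A₀ ⟶ Y`, `u ≫ v = m·𝟙`, `v ≫ ψ = φ₀ ≫ v`) has `weilClassesField Y ψ P' (2k) ⊆ Nᵏ(Y)` for every `P'`.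
* **`exists_weilFieldAnchor_forall_pencil`** — THE CAPSTONE (∃ anchor ∀ pencils, fact-free): the same `(A₀, φ₀)` is such that for EVERY compact
  pencil `f : 𝒳 ⟶ S` of abelian `2ke₀`-folds with `B⋆(𝒳, η) ∀η`, a global endomorphism `Φ` over `S`, `Φ`-compatible charts `(A_s, e_s, φ_s)` with
  `R(φ_s²) = 0`, a rational global `U ∈ H^{2k}(𝒳(ℂ); ℂ)` with `e_t^*(U|X_t) ∈ W_E(A_t) ⊗ ℂ`, `U|X_t ≠ 0`, and an `E`-isogeny pair between ONE chart
  `A_{s₀}` and `A₀`: `W_E(A_s, φ_s) ⊗ ℂ ⊆ Nᵏ(A_s)` for EVERY member `s`. No θ_N, no group law, no Verdier, no `HC_CM`, no Hodge–Weil theorem in print.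

## Honest status

This is the CM-field form of part Q-d for the SPLIT `E`-components (the anchor is polarized split: Deligne Cor. 4.2 (b), André's condition (*));
by Landherr / Deligne's `k₁` (tree: `exists_ratIsometry_powSucc_of_isHyperbolicWeilTypeCM`) every split `E`-Weil datum with parameters
`(R, e₀, k)` is `ℚ`-isometric to this anchor, and its period point is path-connected to the anchor's inside the period domain (tree:
`exists_periodPoint_joinedIn_powSucc_of_isHyperbolicWeilTypeCM`) — the carrier-level shadow of «members of one connected family»; the COMPACT
PENCIL through both with a global `E`-action is André's Lemme 6.3.3 (named fact `andre1996_splitWeilClasses_algebraicallyAnchoredPencil`, NOT used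
here: existence of pencils stays a hypothesis, as on the whole axis). NON-split `E`-components: no anchor exhibited (owed, (o156)). In print the
split `E`-Weil classes with `E⁺ ≠ ℚ` are open ([Andre2026, §4.4.4]); smallest habitat `e₀ = 2`, `k = 2` (part R-d §2). Nothing minimal
claimed; N104 untouched. EDGE LABELS: both theorems K (fact-free; hypothesis-free existence of the anchor).
References: Deligne1982HodgeCycles (§4 Cor. 4.2, Lemma 4.5, Lemma 4.6, Remark 4.10, Thm. 4.8 and proof); Andre1996Motifs (§6.3 Lemme 6.3.3 and
proof, Remarque 2); MoonenZarhin1998WeilClasses (§1); Andre2026 (§4.4.4); Landherr1936HermitianForms; vanGeemen1994HodgeAV (Thm. 4.3).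
-/

noncomputable section

set_option linter.dupNamespace false

namespace Summit.HodgeConjecture.HodgeConjecture.Ring2.AbelianAll

open CategoryTheory CategoryTheory.Limits AlgebraicGeometry Polynomial
open Literature.AlgebraicGeometry Literature.AlgebraicGeometry.Motives
open Literature.AlgebraicGeometry.HodgeTheory Literature.AlgebraicGeometry.Deligne1982
open Literature.Geometry.Kaehler
open Literature.AlgebraicGeometry.VanGeemen1994 (pullbackOne)
open Literature.AlgebraicTopology.SingularHomology (singularCohomology)

/-! ## §1 The anchor for every CM field: Deligne's tensor point on a power of a power of an elliptic curve -/

section Anchor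

/-- **AN UNCONDITIONAL `E`-WEIL ANCHOR FOR EVERY CM FIELD AND EVERY RANK (hypothesis-free, AV level).** For every CM datum `(R, e₀)` (`R ∈ ℤ[S]`
monic of degree `e₀ ≥ 1`, `R(T²)` irreducible over `ℚ`, roots of `R` real negative — `E = ℚ[T]/(R(T²))` a CM field of degree `2e₀`) and every
`k ≥ 1`: an abelian variety `A₀` (namely `(E₁^k)^{2e₀}`, `E₁` an elliptic curve) with an endomorphism `φ₀`, an abelian `k`-fold `T` and a product
cone `q : Fin 2e₀ → (A₀ ⟶ T)` in which `φ₀` is the companion endomorphism of `R(T²)`, such that `(A₀, φ₀)` is of Weil type relative to `E`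
(`IsWeilTypeCM A₀ φ₀ R e₀ k`), ALL of `W_E(A₀) ⊗ ℂ` is algebraic, `A₀` SATISFIES THE HODGE CONJECTURE, `A₀` carries a rational algebraic
Rosati-compatible SPLIT polarization class a non-zero real multiple of which is Kähler, and every `(Y, ψ)` `E`-isogenous to `(A₀, φ₀)` has
algebraic `E`-Weil classes. [cite: Deligne1982HodgeCycles, §4 Lemma 4.5, Remark 4.10 and proof of Thm. 4.8 (a)–(b)]
[cite: Andre1996Motifs, §6.3 proof of Lemme 6.3.3 (p. 33)] [cite: vanGeemen1994HodgeAV, Thm. 4.3] [cite: MoonenZarhin1998WeilClasses, §1] -/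
theorem exists_weilFieldAnchor {R : Polynomial ℤ} {e₀ : ℕ} (he : 0 < e₀) (hRm : R.Monic) (hRe : R.natDegree = e₀)
    (hirr : Irreducible ((R.comp (X ^ 2)).map (Int.castRingHom ℚ)))
    (hroots : ∀ s : ℂ, Polynomial.eval₂ (Int.castRingHom ℂ) s R = 0 → s.im = 0 ∧ s.re < 0) {k : ℕ} (hk : 0 < k) :
    ∃ (A₀ : AbelianVariety ℂ) (φ₀ : A₀ ⟶ A₀) (T : AbelianVariety ℂ) (q : Fin (2 * e₀ - 1 + 1) → (A₀ ⟶ T)),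
      T.dim = k ∧ A₀.dim = (2 * e₀ - 1 + 1) * k ∧ Nonempty (IsLimit (Fan.mk A₀ q)) ∧
      φ₀ ≫ q 0 = -((R.comp (X ^ 2)).coeff 0 • q (Fin.last (2 * e₀ - 1))) ∧
      (∀ j : Fin (2 * e₀ - 1), φ₀ ≫ q j.succ =
        q (Fin.castSucc j) - (R.comp (X ^ 2)).coeff ((j : ℕ) + 1) • q (Fin.last (2 * e₀ - 1))) ∧
      IsWeilTypeCM A₀ φ₀ R e₀ k ∧
      weilClassesField A₀ φ₀ (R.comp (X ^ 2)) (2 * k) ≤ algebraicClasses A₀.X k ∧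
      HodgeConjectureFor A₀.dim A₀.X ∧
      (∃ h : complexBetti A₀.X 2, IsRationalClass h ∧ h ∈ algebraicClasses A₀.X 1 ∧
        (∃ s : ℝ, s ≠ 0 ∧ IsKaehlerClass A₀.dim A₀.X ((s : ℂ) • h)) ∧
        (∀ x y : complexBetti A₀.X 1,
          polarizationPairingOne A₀.X h (A₀.dim - 1) (pullbackOne A₀ φ₀ x) y =
            -polarizationPairingOne A₀.X h (A₀.dim - 1) x (pullbackOne A₀ φ₀ y)) ∧
        Motives.IsHyperbolicWeilType A₀ φ₀ (k * e₀) h) ∧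
      ∀ {Y : AbelianVariety ℂ} {ψ : Y ⟶ Y} (u : Y ⟶ A₀) (v : A₀ ⟶ Y) {m : ℕ}, 0 < m → u ≫ v = m • 𝟙 Y → v ≫ ψ = φ₀ ≫ v →
        ∀ P' : Polynomial ℤ, weilClassesField Y ψ P' (2 * k) ≤ algebraicClasses Y.X k := by
  obtain ⟨k', rfl⟩ : ∃ k', k = k' + 1 := ⟨k - 1, by omega⟩
  obtain ⟨E₁, hE₁⟩ := exists_abelianVariety_dim_eq_one ℂ
  set T : AbelianVariety ℂ := E₁.powSucc k' with hTdef
  have hT : T.dim = k' + 1 := by rw [hTdef, dim_powSucc', hE₁, mul_one]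
  have hn : 2 * e₀ - 1 + 1 = 2 * e₀ := by omega
  obtain ⟨φ₀, hq0, hqs, hW, hWE, h, hh⟩ := exists_tensorPoint_powSucc T (by rw [hT]; omega) he hn hRm hRe hirr hroots
  have hA₀ : (T.powSucc (2 * e₀ - 1)).dim = (2 * e₀ - 1 + 1) * (k' + 1) := by rw [dim_powSucc', hT]
  obtain ⟨hlim⟩ := nonempty_isLimit_fan_powSlots T (2 * e₀ - 1)
  have hPm : (R.comp (X ^ 2)).Monic := hW.monic_comp
  have hPdeg : (R.comp (X ^ 2)).natDegree = 2 * e₀ - 1 + 1 := by rw [hW.natDegree_comp]; omega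
  rw [hT] at hW hWE
  refine ⟨T.powSucc (2 * e₀ - 1), φ₀, T, powSlots T (2 * e₀ - 1), hT, hA₀, ⟨hlim⟩, hq0, hqs, hW, hWE,
    hodgeConjectureFor_powSucc_powSucc hE₁ k' (2 * e₀ - 1), ?_, ?_⟩
  · obtain ⟨hhQ, hhalg, hK, hRos, hsplit⟩ := hh
    rw [hT] at hsplit
    exact ⟨h, hhQ, hhalg, hK, hRos, hsplit⟩
  · intro Y ψ u v m hm huv hv P'
    exact weilClassesField_le_algebraicClasses_of_isogenyPair_companion (by omega) hPm hPdeg hirr hT hA₀ hlim hq0 hqs hm huv hv P'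

end Anchor

/-! ## §2 The capstone: ∃ anchor ∀ pencils, for every CM field -/

section Capstone

/-- **∃ ANCHOR ∀ PENCILS, FOR EVERY CM FIELD (fact-free).** For every CM datum `(R, e₀)` and every `k ≥ 1` there is an `E`-Weil abelian
`2ke₀`-fold `(A₀, φ₀)` (of Weil type relative to `E = ℚ[T]/(R(T²))`, with algebraic `E`-Weil classes, satisfying the Hodge conjecture, polarized
split — §1) such that for EVERY compact pencil `f : 𝒳 ⟶ S` of abelian `2ke₀`-folds with `B⋆(𝒳, η)` for every `η`, a global endomorphism `Φ` over
`S`, `Φ`-compatible charts `(A_s, e_s, φ_s)` with `R(φ_s²) = 0` on every chart, a RATIONAL global class `U ∈ H^{2k}(𝒳(ℂ); ℂ)` with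
`e_t^*(U|X_t) ∈ W_E(A_t, φ_t) ⊗ ℂ` and `U|X_t ≠ 0` at one member, and an `E`-ISOGENY PAIR between one chart `A_{s₀}` and the anchor
(`u : A_{s₀} ⟶ A₀`, `v : A₀ ⟶ A_{s₀}`, `u ≫ v = m·𝟙`, `m ≥ 1`, `v ≫ φ_{s₀} = φ₀ ≫ v`): **`W_E(A_s, φ_s) ⊗ ℂ ⊆ Nᵏ(A_s)` for EVERY member `s`.**
Part R-b's row with the anchor's algebraic `E`-Weil classes carried to the chart along the isogeny pair. No θ_N, no group law, no Verdier, no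
`HC_CM`, no Hodge–Weil theorem in print. [cite: Deligne1982HodgeCycles, §4 Lemma 4.5, Remark 4.10 and proof of Thm. 4.8]
[cite: Andre1996Motifs, §6.3 Lemme 6.3.3 and Remarque 2 (p. 33)] [cite: MoonenZarhin1998WeilClasses, §1 (dim_F W_F = 1)]
[cite: Abdulali1994FamiliesAV, (1.1) and Theorem 5.5 (p. 1130)] [cite: Andre2026, §4.4.4] -/
theorem exists_weilFieldAnchor_forall_pencil {R : Polynomial ℤ} {e₀ : ℕ} (he : 0 < e₀) (hRm : R.Monic) (hRe : R.natDegree = e₀)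
    (hirr : Irreducible ((R.comp (X ^ 2)).map (Int.castRingHom ℚ)))
    (hroots : ∀ s : ℂ, Polynomial.eval₂ (Int.castRingHom ℂ) s R = 0 → s.im = 0 ∧ s.re < 0) {k : ℕ} (hk : 0 < k) :
    ∃ (A₀ : AbelianVariety ℂ) (φ₀ : A₀ ⟶ A₀),
      IsWeilTypeCM A₀ φ₀ R e₀ k ∧ weilClassesField A₀ φ₀ (R.comp (X ^ 2)) (2 * k) ≤ algebraicClasses A₀.X k ∧
      HodgeConjectureFor A₀.dim A₀.X ∧
      (∃ h : complexBetti A₀.X 2, IsRationalClass h ∧ h ∈ algebraicClasses A₀.X 1 ∧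
        (∃ s : ℝ, s ≠ 0 ∧ IsKaehlerClass A₀.dim A₀.X ((s : ℂ) • h)) ∧
        (∀ x y : complexBetti A₀.X 1,
          polarizationPairingOne A₀.X h (A₀.dim - 1) (pullbackOne A₀ φ₀ x) y =
            -polarizationPairingOne A₀.X h (A₀.dim - 1) x (pullbackOne A₀ φ₀ y)) ∧
        Motives.IsHyperbolicWeilType A₀ φ₀ (k * e₀) h) ∧
      ∀ {𝒳 S : SchemeOver ℂ} {f : 𝒳 ⟶ S} (_hf : IsCompactAbelianPencil f (2 * k * e₀))
        (_hB : ∀ ηX : complexBetti 𝒳 2, StandardConjectureBStar (2 * k * e₀ + 1) 𝒳 ηX)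
        (Φ : 𝒳 ⟶ 𝒳) (_hΦ : Φ ≫ f = f)
        (A : ComplexPoints S → AbelianVariety ℂ) (e : ∀ s, (A s).X ≅ fiberOver f s) (φ : ∀ s, A s ⟶ A s)
        (_hK : ∀ s, ∃ Φs : fiberOver f s ⟶ fiberOver f s,
          Φs ≫ fiberι f s = fiberι f s ≫ Φ ∧ (e s).hom ≫ Φs = (φ s).hom.hom.hom ≫ (e s).hom)
        (_hP : ∀ s, Polynomial.eval₂ (Int.castRingHom (CategoryTheory.End (A s))) ((φ s : CategoryTheory.End (A s)))
          (R.comp (X ^ 2)) = 0)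
        (U : complexBetti 𝒳 (2 * k)) (_hUQ : IsRationalClass U) {t : ComplexPoints S}
        (_hUt : complexBetti.map (e t).hom (2 * k) (complexBetti.map (fiberι f t) (2 * k) U) ∈
          weilClassesField (A t) (φ t) (R.comp (X ^ 2)) (2 * k))
        (_hU0 : complexBetti.map (fiberι f t) (2 * k) U ≠ 0)
        {s₀ : ComplexPoints S} (u : A s₀ ⟶ A₀) (v : A₀ ⟶ A s₀) {m : ℕ} (_hm : 0 < m) (_huv : u ≫ v = m • 𝟙 (A s₀))
        (_hv : v ≫ φ s₀ = φ₀ ≫ v) (s : ComplexPoints S),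
        weilClassesField (A s) (φ s) (R.comp (X ^ 2)) (2 * k) ≤ algebraicClasses (A s).X k := by
  obtain ⟨A₀, φ₀, T, q, -, -, -, -, -, hW, hWE, hHC, hh, hiso⟩ := exists_weilFieldAnchor he hRm hRe hirr hroots hk
  refine ⟨A₀, φ₀, hW, hWE, hHC, hh, ?_⟩
  intro 𝒳 S f hf hB Φ hΦ A e φ hK hP U hUQ t hUt hU0 s₀ u v m hm huv hv s
  have her : (2 * e₀) * (2 * k) = 2 * (2 * k * e₀) := by ring
  exact weilClassesField_le_algebraicClasses_forall_of_lefschetzB_of_weilClassesField_le_chart hf hB Φ hΦ A e φ hK hW.natDegree_comp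
    hW.irreducible hP her hk U hUQ hUt hU0 (hiso u v hm huv hv (R.comp (X ^ 2))) s

end Capstone

end Summit.HodgeConjecture.HodgeConjecture.Ring2.AbelianAll

end
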